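import Literature.MathematicalPhysics.QuantumFieldTheory.Balaban1983to89.Beta.AxialComposition
import Literature.MathematicalPhysics.QuantumFieldTheory.Balaban1983to89.Beta.AdjointTransportJets

/-!
# `Beta/FP/AveragingJetLetters` — road «FP» (binder row D1), row **RHOA-6b** (part 1 of 3): the `B`-jets at `𝟙` of
# Bałaban's STRAIGHT-CONTOUR covariant average at blocking `n`, as DERIVATIVES of a defined object and as the
# explicit finite-support KERNEL `q̇(y; b′, b)` (RHOA-DESIGN v1.1 §2bis (q̇); GAMMA-DESIGN §5 «`Q̇`, `Q̈` … explicit»)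

HONEST FRAMING (cell `pub-balaban`, β sub-cell, verbatim): discharging `BetaPertH` makes Bałaban's UV stability
UNCONDITIONAL — a real constructive-QFT result; it is NOT the continuum limit and NOT the Clay problem.  THIS MODULE
discharges NOTHING of the series, of row D1, of `hbook`/`hasym`/ρ: it is [folklore] finite combinatorics on `ℤ⁴`
plus an1's node «ADJOINT-TRANSPORT-JETS» (`Beta.AdjointTransportJets`) BY NAME, applied to the cell's OWN averaging
model at blocking `n` ([our object]).  «not in print; our bookkeeping».  0 estimates of any Bałaban propagator.
HONEST DEPENDENCY: continuum YM on T⁴ ⇐ BetaPertH ∧ nine spine estimates (0/9 proved); BetaPertH ⇐ (D1) ∧ (D4) ∧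
CAP+tail; G-an2-4 gates asym, D1 and NE2/3/4.

ABSOLUTE RULE (cell charter, verbatim): «No internally-minted statement may enter as a cited fact. Every hypothesis is
either kernel-proved in this package or a verbatim quotation of a PUBLISHED theorem with page reference. The
manuscript(s) under audit are NOT citable for their own disputed steps — they are the thing under adjudication;
programme-internal (2001/route/tribunal) claims are never citable.»  Accordingly: no `def … : Prop`, no citation tag,
no hypothesis is a printed statement; the data `def`s below assert nothing.

THE ROW (road-FP owner b2b-balaban-beta-d1-p3, `LEAVES-FP.md` row RHOA-6b; RHOA-DESIGN v1.1 §2bis LETTERS, verbatim):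
«(q̇) `Q̇[β]φ(u) = n⁻⁵Σ_{x∈B(u)}Σ_{s<n}Σ_{s′<s}[β(x+s′e_μ), φ(x+se_μ)]`: for a collinear pair `b − b′ = t·e_μ`,
`0 < t < n`: `Σ_u |q̇(u;b′,b)| ≤ n⁻⁵·(n−t) ≤ n⁻⁴`; given `b′`, fewer than `n` partners `b` ⟹ the β-insertion operator
norm letter `n·n⁻⁴ = n⁻³`; (q̈) likewise `n⁻³` per ordered pair of insertions, support collinear of length `< n`
(ONE-dimensional)».  THIS FILE: the object, both jets as derivatives, the kernel form of the first jet.  The ℓ¹ LETTERS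
of `q̇` are `FP/AveragingJetLettersBounds`; the ordered-nested kernel form of `q̈` and its letters are
`FP/AveragingJetLettersSecond`.

WHAT IS TYPED (`Pt = ℤ⁴`; `𝔸` any normed ℝ-algebra, complete where a derivative is taken; `β φ : Pt → 𝔸` the
`μ`-components of background and fluctuation, a bond `[z, z + e_μ]` being named by its base point `z`; the road's
index set `AxialBlockWeights.idx n = fineBlock n ×ˢ range n` and point map `pt μ (x′, j) = x′ + j·e_μ` of
`AxialComposition.axialAvg`, all BY NAME):
* §0 [folklore] helpers: `list_sum_map_range`, `filter_lt_range`, the UNIQUENESS OF THE BLOCK DECOMPOSITION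
  `block_decomp_unique` (`n•y + x′`, `x′ ∈ [0,n)⁴`, determines `y` and `x′`), `base_unique`, `pt_pos_injective`,
  `pt_eq_pt_add`, `smul_unitVec_injective` — the injectivity facts every letter count of parts 2–3 rests on.
* §1 `covAxialAvg n μ β φ y t := Σ_{(x′,s) ∈ idx n} n⁻⁵ • conjPath ℝ [β(n•y+x′), …, β(n•y+x′+(s−1)e_μ)] (φ(n•y+x′+s e_μ)) t`
  — the straight-contour block average of B5-I (1.11)/(1.18) (`axialAvg`, mass-one normalisation `n⁻⁵`) with every
  field letter adjoint-transported back to its block point along its contour at background `e^{tβ}` (node 6's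
  `avgPath` shape with the straight-contour datum `ctrLetters`).  `covAxialAvg_zero` / `covAxialAvg_zero_real` (at
  `t = 0` it IS `axialAvg`), `hasDerivAt_covAxialAvg` (every `t`), **`hasDerivAt_covAxialAvg_zero`**:
  `HasDerivAt (covAxialAvg n μ β φ y) (axialJet₁ n μ β φ y) 0`, `axialJet₁ = n⁻⁵ Σ_{(x′,s)} [Σ_{j<s} β_{b_j}, φ_{b_s}]`,
  `axialJet₁_eq_triple_sum` (= the row's (q̇) display, verbatim), and **`hasDerivAt_axialD₁_zero`**: the
  first-derivative function `axialD₁` has derivative `axialJet₂ = n⁻⁵ Σ ([S,[S,φ]] + [C,φ])` at `0`,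
  `C = Σ_{i<j<s}[β_{b_i}, β_{b_j}]` (node 6 `conjD₂_zero_eq_comm`: the second `B`-jet).
* §2 KERNEL FORM: `dotIdx n` (triples `((x′,s), j)`, `j < s < n`), `dotMap` (↦ `(b′, b)`), `dotFiber`, `dotCount`,
  `qdot n μ y b′ b := dotCount/n⁵ ≥ 0`, `ctrPts n μ y` (the bond base points met by the block's contours,
  ⊆ `n•y + [0,2n)⁴`), **`axialJet₁_eq_sum_qdot`**:
  `axialJet₁ n μ β φ y = Σ_{b′ ∈ ctrPts} Σ_{b ∈ ctrPts} qdot n μ y b′ b • (β b′·φ b − φ b·β b′)`.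

NOT TYPED HERE (scope): the scalar averaging jet `Q̇′` of B9 (3.19) (tree contours `Γ_{y,x}`, node 5's `axial`); the
BCH-dressed correction terms of the full vector formula B7 (124) (an1 node 4 `Beta.AveragingCorrectionJets`) —
RHOA-DESIGN's (q̇) is the transported straight sum only, followed verbatim; backgrounds `U ≠ 𝟙`; any estimate of `Γ₀`,
`𝓘`, `G_C`; the MIX power counting itself (row RHOA-6c).  Nothing printed is asserted; B5-I (1.11) p. 19 and B9 (3.19)
p. 393 are LOCATORS for which object is modelled (their transcriptions live in `AxialComposition` /
`AdjointTransportJets`, imported).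
-/

noncomputable section

namespace Summit.QuantumFields.BalabanUV.Beta.FP.AveragingJetLetters

open Finset
open scoped BigOperators
open Literature.MathematicalPhysics.QuantumFieldTheory.Balaban1983to89.Beta
open Literature.MathematicalPhysics.QuantumFieldTheory.Balaban1983to89.Beta.DyadicShell (Pt)
open Literature.MathematicalPhysics.QuantumFieldTheory.Balaban1983to89.Beta.BubbleTransfer (unitVec)
open Literature.MathematicalPhysics.QuantumFieldTheory.Balaban1983to89.Beta.AxialBlockWeights
  (fineBlock idx pt mem_fineBlock pt_apply)
open Literature.MathematicalPhysics.QuantumFieldTheory.Balaban1983to89.Beta.AxialComposition (axialAvg)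
open Literature.MathematicalPhysics.QuantumFieldTheory.Balaban1983to89.Beta.TransportVertices (commSum)
open Literature.MathematicalPhysics.QuantumFieldTheory.Balaban1983to89.Beta.AdjointTransportJets
  (conjPath conjD₁ conjD₂ conjPath_zero conjD₁_zero hasDerivAt_conjPath hasDerivAt_conjD₁ conjD₂_zero_eq_comm)

/-! ## §0 Elementary helpers -/

/-- [folklore] a `List.range` sum is the `Finset.range` sum. -/
theorem list_sum_map_range {M : Type*} [AddCommMonoid M] (f : ℕ → M) (s : ℕ) :
    ((List.range s).map f).sum = ∑ j ∈ range s, f j := by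
  induction s with
  | zero => simp
  | succ s ih =>
    rw [List.range_succ, List.map_append, List.sum_append, ih, Finset.sum_range_succ]
    simp

/-- [folklore] `(range n).filter (· < s) = range s` for `s ≤ n`. -/
theorem filter_lt_range {n s : ℕ} (hs : s ≤ n) : (range n).filter (fun j => j < s) = range s := by
  ext j
  simp only [mem_filter, mem_range]
  omega

/-- [folklore] UNIQUENESS OF THE BLOCK DECOMPOSITION: `n•y₁ + x₁ = n•y₂ + x₂` with `x₁, x₂ ∈ [0,n)⁴` forces
`y₁ = y₂` and `x₁ = x₂`. -/
theorem block_decomp_unique {n : ℕ} {y₁ y₂ x₁ x₂ : Pt} (h₁ : x₁ ∈ fineBlock n) (h₂ : x₂ ∈ fineBlock n)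
    (h : n • y₁ + x₁ = n • y₂ + x₂) : y₁ = y₂ ∧ x₁ = x₂ := by
  rw [mem_fineBlock] at h₁ h₂
  have hy : y₁ = y₂ := by
    funext i
    have hi := congrFun h i
    simp only [Pi.add_apply, nsmul_eq_mul, Pi.mul_apply, Pi.natCast_apply] at hi
    obtain ⟨h1a, h1b⟩ := h₁ i
    obtain ⟨h2a, h2b⟩ := h₂ i
    have hn : (0 : ℤ) ≤ (n : ℤ) := Int.natCast_nonneg n
    rcases lt_trichotomy (y₁ i) (y₂ i) with hlt | heq | hgt
    · have hle : y₁ i + 1 ≤ y₂ i := hlt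
      nlinarith [mul_le_mul_of_nonneg_left hle hn]
    · exact heq
    · have hle : y₂ i + 1 ≤ y₁ i := hgt
      nlinarith [mul_le_mul_of_nonneg_left hle hn]
  subst hy
  exact ⟨rfl, add_left_cancel h⟩

/-- [folklore] multiples of `e_μ` are read off the `μ`-coordinate. -/
theorem smul_unitVec_injective {μ : Fin 4} {a b : ℤ} (h : a • unitVec μ = b • unitVec μ) : a = b := by
  have hμ := congrFun h μ
  simpa [unitVec] using hμ

/-- [folklore] the `μ`-position along a contour is read off the point: same block point, same point ⟹ same position. -/
theorem pt_pos_injective {μ : Fin 4} {q₁ q₂ : Pt × ℕ} (hx : q₁.1 = q₂.1) (h : pt μ q₁ = pt μ q₂) : q₁.2 = q₂.2 := by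
  have hμ := congrFun h μ
  simp only [pt_apply, if_true, hx] at hμ
  omega

/-- [folklore] base-point uniqueness along contours: `n•y₁ + pt μ (x₁, j) = n•y₂ + pt μ (x₂, j)` with `x₁, x₂` in the
fine block forces `y₁ = y₂` and `x₁ = x₂`. -/
theorem base_unique {n : ℕ} {μ : Fin 4} {y₁ y₂ x₁ x₂ : Pt} {j : ℕ} (h₁ : x₁ ∈ fineBlock n) (h₂ : x₂ ∈ fineBlock n)
    (h : n • y₁ + pt μ (x₁, j) = n • y₂ + pt μ (x₂, j)) : y₁ = y₂ ∧ x₁ = x₂ := by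
  refine block_decomp_unique h₁ h₂ ?_
  have h' : n • y₁ + x₁ + (j : ℤ) • unitVec μ = n • y₂ + x₂ + (j : ℤ) • unitVec μ := by
    simpa [pt, add_assoc] using h
  exact add_right_cancel h'

/-- [folklore] moving along the contour: `pt μ (x, s) = pt μ (x, j) + (s − j)•e_μ` for `j ≤ s`. -/
theorem pt_eq_pt_add {μ : Fin 4} (x : Pt) {j s : ℕ} (h : j ≤ s) :
    pt μ (x, s) = pt μ (x, j) + ((s - j : ℕ) : ℤ) • unitVec μ := by
  simp only [pt, Nat.cast_sub h, add_assoc, ← add_smul]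
  congr 2
  ring

/-- [folklore] a contour index has its block point in the fine block and its length `< n`. -/
theorem mem_idx_iff {n : ℕ} {q : Pt × ℕ} : q ∈ idx n ↔ q.1 ∈ fineBlock n ∧ q.2 < n := by
  rw [idx, mem_product, mem_range]

/-! ## §1 The straight-contour covariant average at blocking `n` and its jets at `𝟙` -/

section Objects

variable {𝔸 : Type*} [NormedRing 𝔸] [NormedAlgebra ℝ 𝔸]

/-- [our object] the BACKGROUND LETTERS met along the straight contour of `(x′, s) ∈ idx n` from the block `y`:
`[β(n•y + x′), β(n•y + x′ + e_μ), …, β(n•y + x′ + (s−1)e_μ)]` in path order (the bonds the field letter at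
`n•y + x′ + s·e_μ` is transported back through). -/
def ctrLetters (n : ℕ) (μ : Fin 4) (β : Pt → 𝔸) (y : Pt) (q : Pt × ℕ) : List 𝔸 :=
  (List.range q.2).map fun j => β (n • y + pt μ (q.1, j))

/-- [our object] Bałaban's STRAIGHT-CONTOUR COVARIANT AVERAGE at blocking `n`, background `e^{tβ}` (direction `μ`,
block `y`): `n⁻⁵ Σ_{(x′,s)∈idx n} Ad(e^{tβ_{b₀}}⋯e^{tβ_{b_{s−1}}}) φ_{b_s}` — node 6's `conjPath` along `ctrLetters`. -/
def covAxialAvg (n : ℕ) (μ : Fin 4) (β φ : Pt → 𝔸) (y : Pt) (t : ℝ) : 𝔸 :=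
  ∑ q ∈ idx n, ((n : ℝ) ^ 5)⁻¹ • conjPath ℝ (ctrLetters n μ β y q) (φ (n • y + pt μ q)) t

/-- [our object] the first-derivative FUNCTION of the covariant average (node 6's `conjD₁` termwise). -/
def axialD₁ (n : ℕ) (μ : Fin 4) (β φ : Pt → 𝔸) (y : Pt) (t : ℝ) : 𝔸 :=
  ∑ q ∈ idx n, ((n : ℝ) ^ 5)⁻¹ • conjD₁ ℝ (ctrLetters n μ β y q) (φ (n • y + pt μ q)) t

/-- [our object] THE FIRST JET `Q̇[β]φ(y) = n⁻⁵ Σ_{(x′,s)} [S_{x′,s}, φ_{b_s}]`, `S_{x′,s} = Σ_{j<s} β_{b_j}`. -/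
def axialJet₁ (n : ℕ) (μ : Fin 4) (β φ : Pt → 𝔸) (y : Pt) : 𝔸 :=
  ∑ q ∈ idx n, ((n : ℝ) ^ 5)⁻¹ •
    ((ctrLetters n μ β y q).sum * φ (n • y + pt μ q) - φ (n • y + pt μ q) * (ctrLetters n μ β y q).sum)

/-- [our object] THE SECOND JET `Q̈[β,β]φ(y) = n⁻⁵ Σ_{(x′,s)} ([S,[S,φ_{b_s}]] + [C,φ_{b_s}])`,
`C = Σ_{i<j<s}[β_{b_i},β_{b_j}]` (node 6's commutator form, path-ordering letter `C = commSum`). -/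
def axialJet₂ (n : ℕ) (μ : Fin 4) (β φ : Pt → 𝔸) (y : Pt) : 𝔸 :=
  ∑ q ∈ idx n, ((n : ℝ) ^ 5)⁻¹ •
    (((ctrLetters n μ β y q).sum *
          ((ctrLetters n μ β y q).sum * φ (n • y + pt μ q) - φ (n • y + pt μ q) * (ctrLetters n μ β y q).sum)
        - ((ctrLetters n μ β y q).sum * φ (n • y + pt μ q) - φ (n • y + pt μ q) * (ctrLetters n μ β y q).sum)
          * (ctrLetters n μ β y q).sum)
      + (commSum (ctrLetters n μ β y q) * φ (n • y + pt μ q) - φ (n • y + pt μ q) * commSum (ctrLetters n μ β y q)))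

/-- [folklore] at zero background the covariant average is the plain (𝔸-valued) straight-contour average. -/
theorem covAxialAvg_zero (n : ℕ) (μ : Fin 4) (β φ : Pt → 𝔸) (y : Pt) :
    covAxialAvg n μ β φ y 0 = ∑ q ∈ idx n, ((n : ℝ) ^ 5)⁻¹ • φ (n • y + pt μ q) := by
  simp [covAxialAvg]

/-- [folklore] every contour term is differentiable at every `t` (node 6 `hasDerivAt_conjPath` termwise). -/
theorem hasDerivAt_covAxialAvg [CompleteSpace 𝔸] (n : ℕ) (μ : Fin 4) (β φ : Pt → 𝔸) (y : Pt) (t : ℝ) :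
    HasDerivAt (covAxialAvg n μ β φ y) (axialD₁ n μ β φ y t) t := by
  have h := HasDerivAt.fun_sum (u := idx n) (x := t) fun q _ =>
    (hasDerivAt_conjPath ℝ (ctrLetters n μ β y q) (φ (n • y + pt μ q)) t).const_smul (((n : ℝ) ^ 5)⁻¹)
  exact h

/-- THE FIRST `B`-JET OF THE STRAIGHT-CONTOUR COVARIANT AVERAGE AT `𝟙` is `axialJet₁` (node 6 `conjD₁_zero` termwise).
[folklore] -/
theorem hasDerivAt_covAxialAvg_zero [CompleteSpace 𝔸] (n : ℕ) (μ : Fin 4) (β φ : Pt → 𝔸) (y : Pt) :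
    HasDerivAt (covAxialAvg n μ β φ y) (axialJet₁ n μ β φ y) 0 := by
  have h := hasDerivAt_covAxialAvg n μ β φ y 0
  simpa [axialD₁, axialJet₁, conjD₁_zero] using h

/-- THE SECOND `B`-JET AT `𝟙`: the first-derivative function `axialD₁` has derivative `axialJet₂` at `0` (node 6
`hasDerivAt_conjD₁` + `conjD₂_zero_eq_comm` termwise). [folklore] -/
theorem hasDerivAt_axialD₁_zero [CompleteSpace 𝔸] (n : ℕ) (μ : Fin 4) (β φ : Pt → 𝔸) (y : Pt) :
    HasDerivAt (axialD₁ n μ β φ y) (axialJet₂ n μ β φ y) 0 := by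
  have h := HasDerivAt.fun_sum (u := idx n) (x := (0 : ℝ)) fun q _ =>
    (hasDerivAt_conjD₁ ℝ (ctrLetters n μ β y q) (φ (n • y + pt μ q)) 0).const_smul (((n : ℝ) ^ 5)⁻¹)
  have h' : HasDerivAt (fun t => axialD₁ n μ β φ y t) (axialJet₂ n μ β φ y) 0 := by
    simpa [axialD₁, axialJet₂, conjD₂_zero_eq_comm] using h
  exact h'

/-- THE ROW's DISPLAY (q̇), verbatim: `Q̇[β]φ(y) = n⁻⁵ Σ_{x∈B(y)} Σ_{s<n} Σ_{j<s} [β(x + j e_μ), φ(x + s e_μ)]`. [folklore] -/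
theorem axialJet₁_eq_triple_sum (n : ℕ) (μ : Fin 4) (β φ : Pt → 𝔸) (y : Pt) :
    axialJet₁ n μ β φ y = ∑ q ∈ idx n, ∑ j ∈ range q.2, ((n : ℝ) ^ 5)⁻¹ •
      (β (n • y + pt μ (q.1, j)) * φ (n • y + pt μ q) - φ (n • y + pt μ q) * β (n • y + pt μ (q.1, j))) := by
  unfold axialJet₁ ctrLetters
  refine Finset.sum_congr rfl fun q _ => ?_
  rw [list_sum_map_range, Finset.sum_mul, Finset.mul_sum, ← Finset.sum_sub_distrib, Finset.smul_sum]

end Objects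

/-- [folklore] for real-valued fields the zero-background value IS the road's `AxialComposition.axialAvg`. -/
theorem covAxialAvg_zero_real (n : ℕ) (μ : Fin 4) (β φ : Pt → ℝ) (y : Pt) :
    covAxialAvg n μ β φ y 0 = axialAvg n μ φ y := by
  rw [covAxialAvg_zero, axialAvg, Finset.sum_div]
  refine Finset.sum_congr rfl fun q _ => ?_
  rw [smul_eq_mul, div_eq_inv_mul]

/-! ## §2 The kernel form `q̇(y; b′, b)` -/

/-- [our object] the base points of the fine bonds met by the contours of block `y` (⊆ `n•y + [0,2n)⁴`). -/
def ctrPts (n : ℕ) (μ : Fin 4) (y : Pt) : Finset Pt := (idx n).image fun q => n • y + pt μ q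

/-- [our object] the (q̇) index set: a contour `(x′, s) ∈ idx n` and an insertion position `j < s`. -/
def dotIdx (n : ℕ) : Finset ((Pt × ℕ) × ℕ) := (idx n ×ˢ range n).filter fun p => p.2 < p.1.2

/-- [our object] the pair (insertion bond, field bond) of an index triple. -/
def dotMap (n : ℕ) (μ : Fin 4) (y : Pt) (p : (Pt × ℕ) × ℕ) : Pt × Pt :=
  (n • y + pt μ (p.1.1, p.2), n • y + pt μ p.1)

/-- [our object] the fibre of `dotMap` over a bond pair. -/
def dotFiber (n : ℕ) (μ : Fin 4) (y : Pt) (bb : Pt × Pt) : Finset ((Pt × ℕ) × ℕ) :=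
  (dotIdx n).filter fun p => dotMap n μ y p = bb

/-- [our object] the INTEGER KERNEL: how many (contour, position) pairs of block `y` insert `β_{b′}` before `φ_b`. -/
def dotCount (n : ℕ) (μ : Fin 4) (y b' b : Pt) : ℕ := (dotFiber n μ y (b', b)).card

/-- [our object] THE KERNEL `q̇(y; b′, b) = dotCount / n⁵`. -/
def qdot (n : ℕ) (μ : Fin 4) (y b' b : Pt) : ℝ := (dotCount n μ y b' b : ℝ) / (n : ℝ) ^ 5

/-- [folklore] `q̇ ≥ 0`. -/
theorem qdot_nonneg (n : ℕ) (μ : Fin 4) (y b' b : Pt) : 0 ≤ qdot n μ y b' b := by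
  unfold qdot; positivity

/-- [folklore] membership in the index set. -/
theorem mem_dotIdx {n : ℕ} {p : (Pt × ℕ) × ℕ} : p ∈ dotIdx n ↔ p.1 ∈ idx n ∧ p.2 < p.1.2 := by
  constructor
  · intro h
    rw [dotIdx, mem_filter, mem_product] at h
    exact ⟨h.1.1, h.2⟩
  · rintro ⟨h1, h2⟩
    have hs : p.1.2 < n := (mem_idx_iff.mp h1).2
    rw [dotIdx, mem_filter, mem_product, mem_range]
    exact ⟨⟨h1, by omega⟩, h2⟩

/-- [folklore] membership in a fibre. -/
theorem mem_dotFiber {n : ℕ} {μ : Fin 4} {y : Pt} {bb : Pt × Pt} {p : (Pt × ℕ) × ℕ} :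
    p ∈ dotFiber n μ y bb ↔ (p.1 ∈ idx n ∧ p.2 < p.1.2) ∧ dotMap n μ y p = bb := by
  rw [dotFiber, mem_filter, mem_dotIdx]

/-- [folklore] the double sum «over contours, then over positions `j < s`» is a sum over `dotIdx`. -/
theorem sum_idx_sum_range_eq_sum_dotIdx {M : Type*} [AddCommMonoid M] (n : ℕ) (f : (Pt × ℕ) → ℕ → M) :
    ∑ q ∈ idx n, ∑ j ∈ range q.2, f q j = ∑ p ∈ dotIdx n, f p.1 p.2 := by
  rw [dotIdx, Finset.sum_filter, Finset.sum_product]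
  refine Finset.sum_congr rfl fun q hq => ?_
  have hs : q.2 ≤ n := (mem_idx_iff.mp hq).2.le
  rw [← filter_lt_range hs, Finset.sum_filter]

/-- [folklore] `dotMap` lands in `ctrPts × ctrPts`. -/
theorem dotMap_mem {n : ℕ} (μ : Fin 4) (y : Pt) {p : (Pt × ℕ) × ℕ} (hp : p ∈ dotIdx n) :
    dotMap n μ y p ∈ ctrPts n μ y ×ˢ ctrPts n μ y := by
  rw [mem_dotIdx] at hp
  obtain ⟨h1, h2⟩ := hp
  have h1' := mem_idx_iff.mp h1
  refine Finset.mem_product.mpr ⟨?_, ?_⟩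
  · exact Finset.mem_image.mpr ⟨(p.1.1, p.2), mem_idx_iff.mpr ⟨h1'.1, by omega⟩, rfl⟩
  · exact Finset.mem_image.mpr ⟨p.1, h1, rfl⟩

section KernelForm

variable {𝔸 : Type*} [NormedRing 𝔸] [NormedAlgebra ℝ 𝔸]

/-- THE KERNEL FORM OF THE FIRST JET: `Q̇[β]φ(y) = Σ_{b′} Σ_b q̇(y; b′, b)·[β_{b′}, φ_b]`, the sums running over the
finite set `ctrPts n μ y` (outside which `q̇(y; ·, ·)` vanishes, part 2 `dotCount_ne_zero_imp`). [folklore] -/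
theorem axialJet₁_eq_sum_qdot (n : ℕ) (μ : Fin 4) (β φ : Pt → 𝔸) (y : Pt) :
    axialJet₁ n μ β φ y =
      ∑ b' ∈ ctrPts n μ y, ∑ b ∈ ctrPts n μ y, qdot n μ y b' b • (β b' * φ b - φ b * β b') := by
  classical
  have h1 : axialJet₁ n μ β φ y = ∑ p ∈ dotIdx n, ((n : ℝ) ^ 5)⁻¹ •
      (β (dotMap n μ y p).1 * φ (dotMap n μ y p).2 - φ (dotMap n μ y p).2 * β (dotMap n μ y p).1) := by
    rw [axialJet₁_eq_triple_sum, sum_idx_sum_range_eq_sum_dotIdx]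
    rfl
  rw [h1, ← Finset.sum_fiberwise_of_maps_to (fun p hp => dotMap_mem μ y hp), Finset.sum_product]
  refine Finset.sum_congr rfl fun b' _ => Finset.sum_congr rfl fun b _ => ?_
  have hconst : ∀ p ∈ (dotIdx n).filter (fun p => dotMap n μ y p = (b', b)),
      ((n : ℝ) ^ 5)⁻¹ • (β (dotMap n μ y p).1 * φ (dotMap n μ y p).2 - φ (dotMap n μ y p).2 * β (dotMap n μ y p).1)
        = ((n : ℝ) ^ 5)⁻¹ • (β b' * φ b - φ b * β b') := by
    intro p hp
    rw [(Finset.mem_filter.mp hp).2]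
  rw [Finset.sum_congr rfl hconst, Finset.sum_const, ← Nat.cast_smul_eq_nsmul ℝ, smul_smul, qdot, dotCount,
    dotFiber, div_eq_mul_inv]

end KernelForm

end Summit.QuantumFields.BalabanUV.Beta.FP.AveragingJetLetters

end
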